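import Summits.QuantumFields.BalabanUV.T4Continuum.Spine.NE1p.TiltedMeanVisibility

/-!
# T⁴ programme, spine estimate NE1′ (node O3b/H2) — THE SMOOTH-DUAL CURRENCY: the two derivatives a second-order visibility needs
# can sit on the TEST FUNCTIONS `e^{sW}`, `W e^{sW}` instead of on the class law — and where they MUST sit when the classes are sharp

Cell `pub-balaban-gaps` (YM blitz Y1, track G2), seat `ne1` gen 6 (prover-pub-balaban-gaps-ne1-g6-0), record `HOME/ne/NE1.md` §4 rows
R41–R43 (gen 6).  ADDITIVE — imports the seat's gen-5 `TiltedMeanVisibility` (p349580 ✓: `abs_tiltedMean_withDensity_sub_le`,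
`oldInfluenceBudget_of_visibility`; through it gen 4's `tiltedMean_eq_div` ∕ `abs_tiltedMean_le`, gen 3's `OldInfluenceBudget`, gen 2's
`tiltedMean`) ONLY; modifies nothing.  Sibling (same generation): `TiltedMeanSmoothDualTilt` (the tilt family `e^{sW}`, `W e^{sW}` has Taylor
majorants uniform on `|s| ≤ l₀`; the per-slot influence of a fibred atomic slot on the TILTED MEAN; the letter `a = θ₁²Λ` out of the
visibility route).

WHY (gen 6 = an audit of gen 5's currency against the printed representation).  Gen 5 produced the old-component budget from an UNTILTED
L¹∕total-variation VISIBILITY of each slot's unit-lattice weight and located the second small factor in {centring of the slot's linear image}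
× {SMOOTHNESS OF THE UNIT-FIELD CLASS LAW} (`TiltedMeanVisibilityCentred`: `‖D²p‖₁`).  Bałaban's classes are cut by SHARP characteristic
functions — [B14] = CMP 119 (2.17) p. 257 «χ_k(Ω_k) = ∏_{□⊂Ω_k} χ({sup_{p⊂□∼} |U_{k,□}(V_k,∂p) − 1| < ε_kη²})», [B12] = CMP 109 (2.9) p. 266,
[B15] = CMP 122 (1.28) p. 183 (decompositions of unity `1 = χ + (1 − χ)` by indicators of field sets) — so a class piece on the unit lattice
is a smooth background CUT by an indicator, and the question a referee must ask is whether the cut spoils the second order.  This file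
answers it in the kernel, at [folklore] level:
* §1 THE PARENT INEQUALITY behind both currencies (no densities): for finite `π, π'` (`π' ≠ 0`), `|W| ≤ B`, every `s`, `E = e^{sW}`:
  `|tiltedMean W π' s − tiltedMean W π s| ≤ (|∫W·E dπ' − ∫W·E dπ| + B·|∫E dπ' − ∫E dπ|) ∕ ∫E dπ'` (`abs_tiltedMean_sub_le_dual`) — the two
  laws are tested on the TWO functions `W·E`, `E` only; total variation on them = gen 5's density currency, Taylor on them = §3.
* §2 SHARP CLASSES IN THE DENSITY CURRENCY COST NOTHING: the unit-scale indicator set `S` is COMMON to the class piece before and after a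
  sub-unit slot is switched on (`μ|S` vs `(μ.withDensity m)|S`), and `|Δ tiltedMean| ≤ 2B·e^{2|s|B}·(∫|m − c| dμ) ∕ ∫_S m dμ`
  (`abs_tiltedMean_restrict_withDensity_sub_le`): the UNRESTRICTED visibility of the weight against the UNCUT background `μ` — whose
  smoothness ([B14] §2 KIND where the sub-unit constraints are integrated out) is what `TiltedMeanVisibilityCentred` consumes.  The jump
  across `∂S` multiplies both laws and never enters.  (R41: the referee's question, settled — no obstruction, and gen 5's smoothness input
  is confirmed as the right one: it is the smoothness of the background BEFORE the unit-scale cut.)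
* §3 THE SMOOTH-DUAL CURRENCY (R42): a mean-value Taylor majorant (`taylor_two_of_lipschitz_deriv`, `taylor_two_of_deriv_two_bound`) and
  the FIBRED SLOT SWAP `abs_fibred_swap_le`: exterior `u` with weights `ν`, slot kernel `κA u ·` off ∕ `κB u ·` on depending ARBITRARILY
  on the exterior with equal fibre masses ([B15] (0.4) fibrewise), unit field `m u + θ·ℓ v` (additive = linearised transfer, rate `θ`):
  `|Σ_u ν_u Σ_v (κB − κA) g(m u + θ ℓ v)| ≤ G₁|θ|·Σ_u ν_u |Σ_v (κB − κA) ℓ v| + G₂θ²·Σ_u ν_u Σ_v (κA + κB) ℓ v²` — first order × the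
  fibrewise conditional-mean discrepancy (the FLATNESS channel, NE1.md R28 (2)∕R34) + SECOND order; centred fibres ⇒ pure second order
  (`abs_fibred_swap_le_of_centred`).  NO smoothness of any law (the unit-field law is atomic), NO independence of slot and exterior, NO
  cluster expansion — Lindeberg's replacement scheme with one matched moment, fibrewise (R43: the «dependent toy» gen 5's handoff asked for,
  in the strongest form).
* §4 WHERE THE DERIVATIVES MUST SIT — one pair of laws in both currencies: off `δ₀`, on `½δ_h + ½δ_{−h}`: total variation `1` for every
  `h ≠ 0` (`atom_vs_centredPair_apply_zero`), smooth-dual distance `≤ G₂h²` (`abs_centredPair_sub_atom_le`, `integral_centredPair_sub_atom`).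
CONSEQUENCE FOR THE ROW (NE1.md v6 §0 l.12).  Two derivatives are needed SOMEWHERE for the second small factor; they may sit on the class law
(density currency — needs the background smooth BEFORE the unit-scale cut; the cut itself is free, §2) or on the test functions (smooth-dual
currency — needs nothing of the law, §3, but sees a sharp class indicator as part of the test function, so it applies cleanly exactly where
no sharp indicator cuts: the full measure, smooth partitions of unity, or classes whose unit-scale cut is absent).  Either way the located
inputs of the old-slot budget are: centring [conjugation symmetry, kernel `T4AdInvariant`] (else the flatness channel), the linearised transfer
rate `θ₁^{K−j}` [B7 (10), `T4AvgDerivBound`], and ONE smoothness — of the background ([B14] §2 KIND) or of the loop observable (free: a loop is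
a polynomial in the unit bond variables).  Decoupling of the slot from its exterior is NOT among them (§3 conditions on the exterior exactly).
Classification of NE1′ UNCHANGED: WORK-bound ∕ OBJECT-bound ∕ NOT idea-bound.

HONEST FRAMING.  [folklore] measure theory and calculus (tilted measures, `withDensity`∕`restrict`, the mean value inequality, Dirac masses)
and finite-sum bookkeeping over ABSTRACT data; NOTHING of Bałaban's is asserted or instantiated (no slot, weight, kernel or class of his run is
constructed; which unit-scale sets `S` and which backgrounds `μ` realise his classes is row NE1′'s OBJECT-bound content behind NODE O).  The
printed loci above are quoted for the SHAPE of the characteristic functions only.  NE1′ NOT proved; spine 0∕9; (B) 0∕13; one fixed finite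
T⁴ — NOT ℝ⁴, NOT infinite volume, NOT a mass gap, NOT Clay.  0 sorry.
-/

noncomputable section

open MeasureTheory ProbabilityTheory Finset
open scoped BigOperators NNReal ENNReal

namespace Summit.QuantumFields.BalabanUV.T4Continuum.NE1p.TiltedMeanSmoothDual

open Summit.QuantumFields.BalabanUV.T4Continuum.NE1p.DressedMGFForm (tiltedMean)
open Summit.QuantumFields.BalabanUV.T4Continuum.NE1p.TiltedMeanInfluence (tiltedMean_eq_div abs_tiltedMean_le)
open Summit.QuantumFields.BalabanUV.T4Continuum.NE1p.TiltedMeanVisibility (abs_tiltedMean_withDensity_sub_le)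
open Literature.MathematicalPhysics.QuantumFieldTheory.Balaban1983to89

/-! ## §1 The parent inequality: tilted means are Lipschitz in the law in the dual norm of the tilt family `{e^{sW}, W e^{sW}}` -/

section Dual

variable {X : Type*} {mX : MeasurableSpace X} {W : X → ℝ} {B : ℝ}

/-- **THE PARENT INEQUALITY (no densities, no domination).**  `π, π'` two finite measures on `X`, `π'` non-zero, `W`
measurable with `|W| ≤ B`.  For EVERY tilt `s`, with `E = e^{sW}`:
`|tiltedMean W π' s − tiltedMean W π s| ≤ (|∫W·E dπ' − ∫W·E dπ| + B·|∫E dπ' − ∫E dπ|) ∕ ∫E dπ'`.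
The right-hand side is the distance of the two laws tested on the TWO functions `W·E` and `E` only (a dual norm of the
tilt family); bounding both test integrals by total variation gives gen 5's density currency (`TiltedMeanVisibility` §1),
bounding them by Taylor's formula on the test functions gives the smooth-dual currency of §3.  Proof: with `q = N∕Z` the
tilted mean under `π`, `N'∕Z' − q = (N' − N − q·(Z' − Z)) ∕ Z'` (because `N − q·Z = 0`, also when `π = 0`) and `|q| ≤ B`.
[folklore] -/
theorem abs_tiltedMean_sub_le_dual {π π' : Measure X} [IsFiniteMeasure π] [IsFiniteMeasure π'] [NeZero π']
    (hWm : Measurable W) (hW : ∀ x, |W x| ≤ B) (s : ℝ) :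
    |tiltedMean W π' s - tiltedMean W π s|
      ≤ (|(∫ x, W x * Real.exp (s * W x) ∂π') - ∫ x, W x * Real.exp (s * W x) ∂π|
          + B * |(∫ x, Real.exp (s * W x) ∂π') - ∫ x, Real.exp (s * W x) ∂π|)
        / ∫ x, Real.exp (s * W x) ∂π' := by
  obtain ⟨x₀⟩ : Nonempty X := by
    by_contra h
    haveI : IsEmpty X := not_nonempty_iff.mp h
    exact (NeZero.ne π') (Measure.eq_zero_of_isEmpty π')
  have hB : 0 ≤ B := (abs_nonneg _).trans (hW x₀)
  set N := ∫ x, W x * Real.exp (s * W x) ∂π with hN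
  set Z := ∫ x, Real.exp (s * W x) ∂π with hZ
  set N' := ∫ x, W x * Real.exp (s * W x) ∂π' with hN'
  set Z' := ∫ x, Real.exp (s * W x) ∂π' with hZ'
  have hZ'pos : 0 < Z' := T4GenFunBounds.mgf_pos_of_abs_le hWm.aemeasurable (ae_of_all _ hW) s
  have hq : |tiltedMean W π s| ≤ B := abs_tiltedMean_le hW hB s
  have hπ' : tiltedMean W π' s = N' / Z' := tiltedMean_eq_div W π' s
  have hkey : tiltedMean W π' s - tiltedMean W π s = (N' - N - tiltedMean W π s * (Z' - Z)) / Z' := by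
    by_cases hπ : π = 0
    · have hN0 : N = 0 := by rw [hN, hπ, integral_zero_measure]
      have hZ0 : Z = 0 := by rw [hZ, hπ, integral_zero_measure]
      have hq0 : tiltedMean W π s = 0 := by rw [tiltedMean_eq_div W π s, ← hN, hN0, zero_div]
      rw [hπ', hq0, hN0, zero_mul, sub_zero, sub_zero, sub_zero]
    · haveI : NeZero π := ⟨hπ⟩
      have hZpos : 0 < Z := T4GenFunBounds.mgf_pos_of_abs_le hWm.aemeasurable (ae_of_all _ hW) s
      rw [hπ', tiltedMean_eq_div W π s, ← hN, ← hZ]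
      field_simp
      ring
  rw [hkey, abs_div, abs_of_pos hZ'pos]
  refine div_le_div_of_nonneg_right ?_ hZ'pos.le
  calc |N' - N - tiltedMean W π s * (Z' - Z)|
      ≤ |N' - N| + |tiltedMean W π s * (Z' - Z)| := abs_sub _ _
    _ = |N' - N| + |tiltedMean W π s| * |Z' - Z| := by rw [abs_mul]
    _ ≤ |N' - N| + B * |Z' - Z| := by gcongr

/-- The density currency as a child: bounding the two test integrals by `B·e^{|s|B}` resp. `e^{|s|B}` times a common majorant `v` of
`|∫f dπ' − ∫f dπ|` over measurable `|f| ≤ 1` (total variation) gives `|Δ tiltedMean| ≤ 2B·e^{|s|B}·v ∕ ∫E dπ'`. [folklore] -/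
theorem abs_tiltedMean_sub_le_of_tests {π π' : Measure X} [IsFiniteMeasure π] [IsFiniteMeasure π'] [NeZero π']
    (hWm : Measurable W) (hW : ∀ x, |W x| ≤ B) (s : ℝ) {D₀ D₁ : ℝ}
    (h₁ : |(∫ x, W x * Real.exp (s * W x) ∂π') - ∫ x, W x * Real.exp (s * W x) ∂π| ≤ D₁)
    (h₀ : |(∫ x, Real.exp (s * W x) ∂π') - ∫ x, Real.exp (s * W x) ∂π| ≤ D₀) :
    |tiltedMean W π' s - tiltedMean W π s| ≤ (D₁ + B * D₀) / ∫ x, Real.exp (s * W x) ∂π' := by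
  obtain ⟨x₀⟩ : Nonempty X := by
    by_contra h
    haveI : IsEmpty X := not_nonempty_iff.mp h
    exact (NeZero.ne π') (Measure.eq_zero_of_isEmpty π')
  have hB : 0 ≤ B := (abs_nonneg _).trans (hW x₀)
  have hZ'pos : 0 < ∫ x, Real.exp (s * W x) ∂π' :=
    T4GenFunBounds.mgf_pos_of_abs_le hWm.aemeasurable (ae_of_all _ hW) s
  refine (abs_tiltedMean_sub_le_dual hWm hW s).trans (div_le_div_of_nonneg_right ?_ hZ'pos.le)
  gcongr

end Dual

/-! ## §2 Sharp classes in the DENSITY currency: a unit-scale indicator common to both laws costs nothing -/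

section Indicator

variable {X : Type*} {mX : MeasurableSpace X} {μ : Measure X} [IsFiniteMeasure μ] {W : X → ℝ} {B : ℝ}

/-- **A COMMON SHARP INDICATOR IS FREE IN THE DENSITY CURRENCY.**  `μ` finite on the unit-lattice space `X` (the class piece's
law with only the SUB-unit-scale constraints imposed — smooth where [B14] §2's small-field analyticity makes it so), `S ⊆ X`
measurable (the unit-scale small∕large-field indicator set of the class: Bałaban's characteristic functions are SHARP —
[B14] (2.17) p. 257 `χ_k(Ω_k) = ∏ χ({sup |U_{k,□}(V_k,∂p) − 1| < ε_kη²})`, [B12] (2.9) p. 266, [B15] (1.28) p. 183), `m : X → ℝ≥0`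
the unit-lattice weight of a slot switched on (gen 5 `exists_unitLattice_weight`), `|W| ≤ B`.  The class piece is `μ|S` off and
`(μ.withDensity m)|S` on — the SAME indicator applied after the slot acts — and for every tilt `s`, every level `c`:
`|tiltedMean W ((μ.withDensity m)|S) s − tiltedMean W (μ|S) s| ≤ 2B·e^{2|s|B}·(∫ |m − c| dμ) ∕ (∫_S m dμ)`:
the UNRESTRICTED L¹-visibility of the weight (second order for centred slots against a smooth `μ`, sibling
`TiltedMeanVisibilityCentred`) over the class piece's re-weighted mass.  The jump of the class law across `∂S` never enters: it
multiplies both laws. [folklore] -/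
theorem abs_tiltedMean_restrict_withDensity_sub_le (hWm : Measurable W) (hW : ∀ x, |W x| ≤ B) {m : X → ℝ≥0}
    (hmm : Measurable m) (hmi : Integrable (fun x => (m x : ℝ)) μ) {S : Set X} (hS : MeasurableSet S)
    (hm0 : 0 < ∫ x in S, (m x : ℝ) ∂μ) (s c : ℝ) :
    |tiltedMean W ((μ.withDensity fun x => m x).restrict S) s - tiltedMean W (μ.restrict S) s|
      ≤ 2 * B * Real.exp (2 * (|s| * B)) * (∫ x, |(m x : ℝ) - c| ∂μ) / ∫ x in S, (m x : ℝ) ∂μ := by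
  have hμS : μ.restrict S ≠ 0 := by
    intro h; rw [h, integral_zero_measure] at hm0; exact lt_irrefl _ hm0
  obtain ⟨x₀⟩ : Nonempty X := by
    by_contra h
    haveI : IsEmpty X := not_nonempty_iff.mp h
    exact hμS (Measure.eq_zero_of_isEmpty _)
  have hB : 0 ≤ B := (abs_nonneg _).trans (hW x₀)
  rw [restrict_withDensity hS]
  refine (abs_tiltedMean_withDensity_sub_le (μ := μ.restrict S) hWm hW hmm hmi.restrict hm0 s c).trans ?_
  have hint : ∫ x in S, |(m x : ℝ) - c| ∂μ ≤ ∫ x, |(m x : ℝ) - c| ∂μ :=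
    setIntegral_le_integral (hmi.sub (integrable_const c)).abs (ae_of_all _ fun x => abs_nonneg _)
  exact div_le_div_of_nonneg_right (mul_le_mul_of_nonneg_left hint (by positivity)) hm0.le

end Indicator

/-! ## §3 The smooth-dual currency: Taylor on the test function — a DEPENDENT fibred slot, no smoothness of any law, no decoupling -/

section Taylor

/-- **SECOND-ORDER TAYLOR MAJORANT FROM A LIPSCHITZ DERIVATIVE.**  If `g` has derivative `g'` everywhere and `g'` is
`G₂`-Lipschitz, then `|g(x + h) − g(x) − h·g'(x)| ≤ G₂·h²` for all `x, h` (mean value inequality applied to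
`u ↦ g(x+u) − g(x) − u·g'(x)` on the segment `[0, h]`; the sharp constant `G₂∕2` is not needed). [folklore] -/
theorem taylor_two_of_lipschitz_deriv {g g' : ℝ → ℝ} {G₂ : ℝ} (hg : ∀ x, HasDerivAt g (g' x) x)
    (hg' : ∀ x y, |g' x - g' y| ≤ G₂ * |x - y|) (x h : ℝ) :
    |g (x + h) - g x - h * g' x| ≤ G₂ * h ^ 2 := by
  have hG₂ : 0 ≤ G₂ := by
    have h1 := hg' 1 0
    rw [sub_zero, abs_one, mul_one] at h1
    exact (abs_nonneg _).trans h1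
  set φ : ℝ → ℝ := fun u => g (x + u) - g x - u * g' x with hφdef
  have hφ : ∀ u, HasDerivAt φ (g' (x + u) - g' x) u := by
    intro u
    have h1 : HasDerivAt (fun u => g (x + u)) (g' (x + u)) u := by
      have h := (hg (x + u)).comp u ((hasDerivAt_id u).const_add x)
      simpa only [Function.comp_def, mul_one] using h
    have h2 : HasDerivAt (fun u => u * g' x) (g' x) u := hasDerivAt_mul_const (g' x)
    have h3 := (h1.sub_const (g x)).sub h2
    exact h3
  have hbound : ∀ u ∈ Set.uIcc 0 h, ‖g' (x + u) - g' x‖ ≤ G₂ * |h| := by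
    intro u hu
    rw [Real.norm_eq_abs]
    calc |g' (x + u) - g' x| ≤ G₂ * |x + u - x| := hg' _ _
      _ = G₂ * |u - 0| := by rw [add_sub_cancel_left, sub_zero]
      _ ≤ G₂ * |h - 0| := mul_le_mul_of_nonneg_left (Set.abs_sub_left_of_mem_uIcc hu) hG₂
      _ = G₂ * |h| := by rw [sub_zero]
  have hmvt := (convex_uIcc (0 : ℝ) h).norm_image_sub_le_of_norm_hasDerivWithin_le
    (fun u _ => (hφ u).hasDerivWithinAt) hbound Set.left_mem_uIcc Set.right_mem_uIcc
  have hφ0 : φ 0 = 0 := by simp only [hφdef, add_zero, sub_self, zero_mul]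
  have hφh : φ h = g (x + h) - g x - h * g' x := rfl
  rw [hφ0, sub_zero, Real.norm_eq_abs, Real.norm_eq_abs, sub_zero, hφh] at hmvt
  calc |g (x + h) - g x - h * g' x| ≤ G₂ * |h| * |h| := hmvt
    _ = G₂ * h ^ 2 := by rw [mul_assoc, ← abs_mul, abs_mul_self, sq]

/-- … and a bounded second derivative makes the first derivative Lipschitz: `|g''| ≤ G₂` ⇒ `|g(x+h) − g(x) − h·g'(x)| ≤ G₂·h²`.
[folklore] -/
theorem taylor_two_of_deriv_two_bound {g g' g'' : ℝ → ℝ} {G₂ : ℝ} (hg : ∀ x, HasDerivAt g (g' x) x)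
    (hg' : ∀ x, HasDerivAt g' (g'' x) x) (hG₂ : ∀ x, |g'' x| ≤ G₂) (x h : ℝ) :
    |g (x + h) - g x - h * g' x| ≤ G₂ * h ^ 2 := by
  refine taylor_two_of_lipschitz_deriv hg (fun a b => ?_) x h
  -- `|g''| ≤ G₂` makes `g'` `G₂`-Lipschitz (Mathlib's mean value inequality on `univ`)
  have hab := convex_univ.norm_image_sub_le_of_norm_hasDerivWithin_le (f := g') (f' := g'') (C := G₂)
    (fun z _ => (hg' z).hasDerivWithinAt) (fun z _ => by rw [Real.norm_eq_abs]; exact hG₂ z)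
    (Set.mem_univ b) (Set.mem_univ a)
  simpa only [Real.norm_eq_abs] using hab

/-- **THE FIBRED SLOT SWAP, TAYLOR ON THE TEST FUNCTION (DEPENDENT, LAW-SMOOTHNESS-FREE).**  Finite model of ONE slot of a class
law seen from the unit lattice through an ADDITIVE (linearised) transfer: exterior configurations `u ∈ EU` with weights
`ν u ≥ 0` (the exterior marginal), slot values `v ∈ EV` drawn from a kernel `κA u ·` (slot off) or `κB u ·` (slot on) — BOTH
DEPENDING ON THE EXTERIOR ARBITRARILY, with equal fibre masses `Σ_v κA u v = Σ_v κB u v` ([B15] (0.4) fibrewise: the ℝ-substitution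
preserves the fibre integrals) — and unit-field value `m u + θ·ℓ v` (the exterior's contribution `m u` ARBITRARY, the slot's LINEAR
image `ℓ v` transferred with rate `θ`; in the application `θ = θ₁^{K−j}`).  For a test function `g` with `|g'| ≤ G₁` and second-order
Taylor majorant `G₂`:
`|Σ_u ν_u Σ_v (κB − κA)(u,v)·g(m u + θ ℓ v)| ≤ G₁·|θ|·Σ_u ν_u·|Σ_v (κB − κA)(u,v)·ℓ v| + G₂·θ²·Σ_u ν_u Σ_v (κA + κB)(u,v)·(ℓ v)²`.
First term = the FLATNESS channel (first order × the fibrewise conditional-mean discrepancy of the slot's linear image — NE1.md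
R28 (2) ∕ R34: it vanishes at conjugation-invariant exteriors); second term = SECOND order in the transfer rate against second
moments.  NO smoothness of any law (the unit-field law here is ATOMIC), NO independence of slot and exterior, NO cluster
expansion: conditioning on the exterior is exact (tower property), Taylor acts on `g` alone.  This is Lindeberg's replacement
scheme (one summand swapped, smooth test function) with one matched moment, fibrewise. [folklore] -/
theorem abs_fibred_swap_le {U V : Type*} {EU : Finset U} {EV : Finset V} {ν : U → ℝ} {κA κB : U → V → ℝ}
    {m : U → ℝ} {ℓ : V → ℝ} {θ : ℝ} {g g' : ℝ → ℝ} {G₁ G₂ : ℝ}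
    (hν : ∀ u ∈ EU, 0 ≤ ν u) (hκA : ∀ u ∈ EU, ∀ v ∈ EV, 0 ≤ κA u v) (hκB : ∀ u ∈ EU, ∀ v ∈ EV, 0 ≤ κB u v)
    (hmass : ∀ u ∈ EU, ∑ v ∈ EV, κA u v = ∑ v ∈ EV, κB u v)
    (hg : ∀ x h : ℝ, |g (x + h) - g x - h * g' x| ≤ G₂ * h ^ 2) (hg' : ∀ x, |g' x| ≤ G₁) :
    |∑ u ∈ EU, ν u * ∑ v ∈ EV, (κB u v - κA u v) * g (m u + θ * ℓ v)|
      ≤ G₁ * |θ| * ∑ u ∈ EU, ν u * |∑ v ∈ EV, (κB u v - κA u v) * ℓ v|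
        + G₂ * θ ^ 2 * ∑ u ∈ EU, ν u * ∑ v ∈ EV, (κA u v + κB u v) * ℓ v ^ 2 := by
  have hG₁ : 0 ≤ G₁ := (abs_nonneg _).trans (hg' 0)
  -- one fibre
  have hfib : ∀ u ∈ EU, |∑ v ∈ EV, (κB u v - κA u v) * g (m u + θ * ℓ v)|
      ≤ G₁ * |θ| * |∑ v ∈ EV, (κB u v - κA u v) * ℓ v|
        + G₂ * θ ^ 2 * ∑ v ∈ EV, (κA u v + κB u v) * ℓ v ^ 2 := by
    intro u hu
    set R : V → ℝ := fun v => g (m u + θ * ℓ v) - g (m u) - θ * ℓ v * g' (m u) with hR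
    have hRb : ∀ v, |R v| ≤ G₂ * (θ * ℓ v) ^ 2 := fun v => hg (m u) (θ * ℓ v)
    have hsplit : ∑ v ∈ EV, (κB u v - κA u v) * g (m u + θ * ℓ v)
        = g (m u) * (∑ v ∈ EV, κB u v - ∑ v ∈ EV, κA u v)
          + θ * g' (m u) * ∑ v ∈ EV, (κB u v - κA u v) * ℓ v
          + ∑ v ∈ EV, (κB u v - κA u v) * R v := by
      rw [← sum_sub_distrib, mul_sum, mul_sum, ← sum_add_distrib, ← sum_add_distrib]
      refine sum_congr rfl fun v _ => ?_
      simp only [hR]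
      ring
    rw [hsplit, ← hmass u hu, sub_self, mul_zero, zero_add]
    calc |θ * g' (m u) * ∑ v ∈ EV, (κB u v - κA u v) * ℓ v + ∑ v ∈ EV, (κB u v - κA u v) * R v|
        ≤ |θ * g' (m u) * ∑ v ∈ EV, (κB u v - κA u v) * ℓ v| + |∑ v ∈ EV, (κB u v - κA u v) * R v| :=
          abs_add_le _ _
      _ ≤ G₁ * |θ| * |∑ v ∈ EV, (κB u v - κA u v) * ℓ v| + ∑ v ∈ EV, (κA u v + κB u v) * (G₂ * (θ * ℓ v) ^ 2) := by
          gcongr with v hv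
          · rw [abs_mul, abs_mul, mul_comm |θ|]
            gcongr
            exact hg' _
          · refine (abs_sum_le_sum_abs _ _).trans (sum_le_sum fun v hv => ?_)
            rw [abs_mul]
            refine mul_le_mul ?_ (hRb v) (abs_nonneg _) (add_nonneg (hκA u hu v hv) (hκB u hu v hv))
            have hA := hκA u hu v hv
            have hB := hκB u hu v hv
            rw [abs_le]; constructor <;> linarith
      _ = G₁ * |θ| * |∑ v ∈ EV, (κB u v - κA u v) * ℓ v| + G₂ * θ ^ 2 * ∑ v ∈ EV, (κA u v + κB u v) * ℓ v ^ 2 := by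
          congr 1
          rw [mul_sum]
          refine sum_congr rfl fun v _ => ?_
          ring
  -- sum over the fibres
  calc |∑ u ∈ EU, ν u * ∑ v ∈ EV, (κB u v - κA u v) * g (m u + θ * ℓ v)|
      ≤ ∑ u ∈ EU, |ν u * ∑ v ∈ EV, (κB u v - κA u v) * g (m u + θ * ℓ v)| := abs_sum_le_sum_abs _ _
    _ = ∑ u ∈ EU, ν u * |∑ v ∈ EV, (κB u v - κA u v) * g (m u + θ * ℓ v)| :=
        sum_congr rfl fun u hu => by rw [abs_mul, abs_of_nonneg (hν u hu)]
    _ ≤ ∑ u ∈ EU, ν u * (G₁ * |θ| * |∑ v ∈ EV, (κB u v - κA u v) * ℓ v|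
          + G₂ * θ ^ 2 * ∑ v ∈ EV, (κA u v + κB u v) * ℓ v ^ 2) :=
        sum_le_sum fun u hu => mul_le_mul_of_nonneg_left (hfib u hu) (hν u hu)
    _ = G₁ * |θ| * ∑ u ∈ EU, ν u * |∑ v ∈ EV, (κB u v - κA u v) * ℓ v|
          + G₂ * θ ^ 2 * ∑ u ∈ EU, ν u * ∑ v ∈ EV, (κA u v + κB u v) * ℓ v ^ 2 := by
        rw [mul_sum, mul_sum, ← sum_add_distrib]
        refine sum_congr rfl fun u _ => ?_
        ring

/-- **CENTRED FIBRES ⇒ PURE SECOND ORDER.**  If in addition the slot's linear image has the same fibrewise conditional mean off and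
on, `Σ_v κA u v·ℓ v = Σ_v κB u v·ℓ v` for every exterior `u` (conjugation symmetry at a flat exterior, kernel `T4AdInvariant`; in
general the equality FAILS off the flat orbit — NE1.md R34 — and the flatness channel of `abs_fibred_swap_le` is what remains), then
`|Σ_u ν_u Σ_v (κB − κA)(u,v)·g(m u + θ ℓ v)| ≤ G₂·θ²·Σ_u ν_u Σ_v (κA + κB)(u,v)·(ℓ v)²` — second order in the transfer rate `θ`,
whatever the dependence of the slot on its exterior and however rough the unit-field law. [folklore] -/
theorem abs_fibred_swap_le_of_centred {U V : Type*} {EU : Finset U} {EV : Finset V} {ν : U → ℝ} {κA κB : U → V → ℝ}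
    {m : U → ℝ} {ℓ : V → ℝ} {θ : ℝ} {g g' : ℝ → ℝ} {G₁ G₂ : ℝ}
    (hν : ∀ u ∈ EU, 0 ≤ ν u) (hκA : ∀ u ∈ EU, ∀ v ∈ EV, 0 ≤ κA u v) (hκB : ∀ u ∈ EU, ∀ v ∈ EV, 0 ≤ κB u v)
    (hmass : ∀ u ∈ EU, ∑ v ∈ EV, κA u v = ∑ v ∈ EV, κB u v)
    (hmean : ∀ u ∈ EU, ∑ v ∈ EV, κA u v * ℓ v = ∑ v ∈ EV, κB u v * ℓ v)
    (hg : ∀ x h : ℝ, |g (x + h) - g x - h * g' x| ≤ G₂ * h ^ 2) (hg' : ∀ x, |g' x| ≤ G₁) :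
    |∑ u ∈ EU, ν u * ∑ v ∈ EV, (κB u v - κA u v) * g (m u + θ * ℓ v)|
      ≤ G₂ * θ ^ 2 * ∑ u ∈ EU, ν u * ∑ v ∈ EV, (κA u v + κB u v) * ℓ v ^ 2 := by
  have h := abs_fibred_swap_le hν hκA hκB hmass hg hg' (m := m) (ℓ := ℓ) (θ := θ)
  have h0 : ∑ u ∈ EU, ν u * |∑ v ∈ EV, (κB u v - κA u v) * ℓ v| = 0 := by
    refine sum_eq_zero fun u hu => ?_
    have : ∑ v ∈ EV, (κB u v - κA u v) * ℓ v = 0 := by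
      simp only [sub_mul, sum_sub_distrib, hmean u hu, sub_self]
    rw [this, abs_zero, mul_zero]
  rw [h0, mul_zero, zero_add] at h
  exact h

end Taylor

/-! ## §4 The two currencies on one pair of laws: a centred two-point displacement of an atom -/

section Witness

/-- **WHERE THE DERIVATIVES MUST SIT.**  Off: the unit field is the atom `δ₀`; on: the centred displacement `½δ_h + ½δ_{−h}`,
`h ≠ 0` (the fibred model of §3 with one exterior, `ℓ = ±1`, `θ = h`).  (i) In the DENSITY currency the two laws are as far apart as
laws can be: the set `{0}` has mass `1` off and `0` on (total variation `1` for EVERY `h` — an atomic background has no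
smoothness for the displacement to be measured against; a class piece cut by a sharp indicator from a background that is itself
ROUGH at the cut behaves the same way at first order, whereas against a smooth background the cut is free, §2).  (ii) In the SMOOTH-DUAL currency they are `G₂·h²`-close on every test function
with Taylor majorant `G₂`: `|½g(h) + ½g(−h) − g(0)| ≤ G₂·h²`.  Bałaban's class laws have smooth backgrounds where [B14] §2 applies
and SHARP unit-scale indicators ([B14] (2.17)): there the density currency is the right one (§2 — the indicator is common) and its
smoothness input (sibling `TiltedMeanVisibilityCentred`, NE1.md R39) is genuinely used; the smooth-dual currency dispenses with it
exactly where no sharp indicator cuts (the full measure; smooth partitions of unity). [folklore] -/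
theorem atom_vs_centredPair_apply_zero {h : ℝ} (hh : h ≠ 0) :
    (Measure.dirac (0 : ℝ)) {0} = 1 ∧
      ((2⁻¹ : ℝ≥0∞) • Measure.dirac h + (2⁻¹ : ℝ≥0∞) • Measure.dirac (-h)) {0} = 0 := by
  refine ⟨?_, ?_⟩
  · rw [Measure.dirac_apply' _ (measurableSet_singleton 0)]
    simp
  · rw [Measure.add_apply, Measure.smul_apply, Measure.smul_apply,
      Measure.dirac_apply' _ (measurableSet_singleton 0), Measure.dirac_apply' _ (measurableSet_singleton 0)]
    have h1 : (h : ℝ) ∉ ({0} : Set ℝ) := by simpa using hh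
    have h2 : (-h : ℝ) ∉ ({0} : Set ℝ) := by simpa using hh
    simp [Set.indicator_of_notMem h1, Set.indicator_of_notMem h2]

/-- (ii) of the witness: the same pair tested on a function with second-order Taylor majorant `G₂`. [folklore] -/
theorem abs_centredPair_sub_atom_le {g g' : ℝ → ℝ} {G₂ : ℝ}
    (hg : ∀ x h : ℝ, |g (x + h) - g x - h * g' x| ≤ G₂ * h ^ 2) (h : ℝ) :
    |2⁻¹ * g h + 2⁻¹ * g (-h) - g 0| ≤ G₂ * h ^ 2 := by
  have h1 := hg 0 h
  have h2 := hg 0 (-h)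
  rw [zero_add] at h1 h2
  rw [neg_sq] at h2
  have e : 2⁻¹ * g h + 2⁻¹ * g (-h) - g 0 = 2⁻¹ * ((g h - g 0 - h * g' 0) + (g (-h) - g 0 - -h * g' 0)) := by ring
  rw [e, abs_mul, abs_of_pos (by norm_num : (0 : ℝ) < 2⁻¹)]
  have h3 := abs_add_le (g h - g 0 - h * g' 0) (g (-h) - g 0 - -h * g' 0)
  linarith [h3, h1, h2]

/-- The integrals behind (ii): `∫ g d(½δ_h + ½δ_{−h}) − ∫ g dδ₀ = ½g(h) + ½g(−h) − g(0)` for every `g : ℝ → ℝ` (any function is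
integrable against a Dirac mass on `ℝ`). [folklore] -/
theorem integral_centredPair_sub_atom (g : ℝ → ℝ) (h : ℝ) :
    (∫ x, g x ∂((2⁻¹ : ℝ≥0∞) • Measure.dirac h + (2⁻¹ : ℝ≥0∞) • Measure.dirac (-h))) - ∫ x, g x ∂(Measure.dirac 0)
      = 2⁻¹ * g h + 2⁻¹ * g (-h) - g 0 := by
  -- any real function is integrable against a Dirac mass on `ℝ` (it is a.e. constant)
  have hi : ∀ a : ℝ, Integrable g (Measure.dirac a) := fun a => (integrable_const (g a)).congr (ae_eq_dirac g).symm
  rw [integral_add_measure ((hi h).smul_measure (by simp)) ((hi (-h)).smul_measure (by simp)),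
    integral_smul_measure, integral_smul_measure, integral_dirac, integral_dirac, integral_dirac]
  simp [ENNReal.toReal_inv]

end Witness


end Summit.QuantumFields.BalabanUV.T4Continuum.NE1p.TiltedMeanSmoothDual

end
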